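import Mathlib
import Literature.Computability.AlgebraicComplexity.NestFreeMatchingFifo
import Summits.ValiantsHypothesis.ValiantsHypothesis.Theorems.FifoMatchingNNLinearDegreeCofactorHardWordPrefixCounts
import Summits.ValiantsHypothesis.ValiantsHypothesis.Theorems.FifoMatchingNNLinearDegreeCofactorHardShedWordDefs
import HarnessLib

/-!
# Crux `NNLinearDegreeCofactorHard` (stmt-ValiantsHypothesis-23918), line `internal_cofactor`, stub S2b (ii):
# the shed queue word — prefix counts, ballot-ness, `R`-avoidance, the support lemma, and the adaptive drain

Sequel of `…ShedWordDefs` (design memo `Lines/internal_cofactor-S2b-shed-design-p1.md`).  For the word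
`shedWord R H E y` on the window `Fin N`:

* `pushes_eq_card_openerSet` / `pops_eq_card_closerSet` — the list bookkeeping of the prefix recursion agrees with
  the opener / closer position sets of `Literature.…NestFreeMatchingFifo`;
* `card_closerSet_lt_le`, `isBallot_shedWord` — the prefix condition (an empty queue pushes), hence the word is a
  ballot word whenever it is balanced (via `InflateWord.isBallot_of_prefix_le`);
* `fifo_shedWord_not_mem`, `fifo_shedWord_mem` — **support lemma**: defects push, so the FIFO matching of a
  balanced shed word is a nest-free perfect matching AVOIDING `R × R`, i.e. it lies in the family `𝓕_R` of
  `…AvoidingCounts.lt_complexity_of_counts`, for every bit string;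
* `pushes_pops_tail`, `balanced_shedWord` — the adaptive drain: if `H ≤ E ≤ N`, `N` is even, non-defects
  outnumber defects in every suffix starting at a non-defect tail position (the carving's good ends) and the tail
  is long enough for the height at `E` (`h(E) + r ≤ T`), the word ends at height `0`.

Nothing here bears on VP ≠ VNP (not proved); S2b and the crux stay open. [folklore]
-/

-- Sub = Summit single-conjunct layout: the duplicated namespace component is mandated by the tree.
set_option linter.dupNamespace false

namespace Summit.ValiantsHypothesis.ValiantsHypothesis.Theorems.FifoMatching.NNLinearDegreeCofactorHard.ShedWord

open Finset

/-! ### Counting bridge: prefix lists versus position sets -/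

section Queue

open Literature.Computability.AlgebraicComplexity

variable {N : ℕ} (R : Finset (Fin N)) (H E : ℕ) (y : Fin N → Bool)

/-- The number of pushes in the length-`t` prefix is the number of positions `< t` whose letter is a push. [folklore] -/
theorem pushes_shedPrefix (t : ℕ) :
    pushes (shedPrefix R H E y t) = ((range t).filter fun i => shedLetter R H E y i = true).card := by
  induction t with
  | zero => simp [shedPrefix]
  | succ t ih =>
    rw [shedPrefix_succ, pushes_append_singleton, ih, range_add_one, filter_insert]
    have hnot : t ∉ (range t).filter fun i => shedLetter R H E y i = true := fun h =>
      absurd (mem_range.1 (mem_filter.1 h).1) (lt_irrefl t)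
    cases hl : shedLetter R H E y t
    · simp
    · simp [card_insert_of_notMem hnot]

/-- The number of pops in the length-`t` prefix is the number of positions `< t` whose letter is a pop. [folklore] -/
theorem pops_shedPrefix (t : ℕ) :
    pops (shedPrefix R H E y t) = ((range t).filter fun i => shedLetter R H E y i = false).card := by
  induction t with
  | zero => simp [shedPrefix]
  | succ t ih =>
    rw [shedPrefix_succ, pops_append_singleton, ih, range_add_one, filter_insert]
    have hnot : t ∉ (range t).filter fun i => shedLetter R H E y i = false := fun h =>
      absurd (mem_range.1 (mem_filter.1 h).1) (lt_irrefl t)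
    cases hl : shedLetter R H E y t
    · simp [card_insert_of_notMem hnot]
    · simp

/-- Window positions `< t` with a given letter, counted in `Fin N`, versus natural-number positions (`t ≤ N`). [folklore] -/
theorem card_filter_val_lt (b : Bool) {t : ℕ} (ht : t ≤ N) :
    ((univ.filter fun i : Fin N => shedWord R H E y i = b).filter fun i => i.val < t).card =
      ((range t).filter fun i => shedLetter R H E y i = b).card := by
  rw [← card_image_of_injective _ Fin.val_injective]
  congr 1
  ext i
  simp only [mem_image, mem_filter, mem_univ, true_and, mem_range, shedWord_apply]
  constructor
  · rintro ⟨j, ⟨hj, hjt⟩, rfl⟩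
    exact ⟨hjt, hj⟩
  · rintro ⟨hit, hi⟩
    exact ⟨⟨i, lt_of_lt_of_le hit ht⟩, ⟨hi, hit⟩, rfl⟩

/-- Pushes of the prefix = openers before `t`. [folklore] -/
theorem pushes_eq_card_openerSet {t : ℕ} (ht : t ≤ N) :
    pushes (shedPrefix R H E y t) = ((openerSet (shedWord R H E y)).filter fun i => i.val < t).card := by
  rw [pushes_shedPrefix, openerSet, card_filter_val_lt R H E y true ht]

/-- Pops of the prefix = closers before `t`. [folklore] -/
theorem pops_eq_card_closerSet {t : ℕ} (ht : t ≤ N) :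
    pops (shedPrefix R H E y t) = ((closerSet (shedWord R H E y)).filter fun i => i.val < t).card := by
  rw [pops_shedPrefix, closerSet, card_filter_val_lt R H E y false ht]

/-- All openers / closers are before `N`. [folklore] -/
theorem filter_val_lt_of_le (S : Finset (Fin N)) {t : ℕ} (ht : N ≤ t) :
    (S.filter fun i : Fin N => i.val < t) = S :=
  filter_true_of_mem fun i _ => lt_of_lt_of_le i.isLt ht

/-- **Prefix condition** in position-set form: at every time, closers so far ≤ openers so far. [folklore] -/
theorem card_closerSet_lt_le (hbal : (closerSet (shedWord R H E y)).card = (openerSet (shedWord R H E y)).card)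
    (t : ℕ) :
    ((closerSet (shedWord R H E y)).filter fun i => i.val < t).card ≤
      ((openerSet (shedWord R H E y)).filter fun i => i.val < t).card := by
  by_cases ht : t ≤ N
  · rw [← pushes_eq_card_openerSet R H E y ht, ← pops_eq_card_closerSet R H E y ht]
    exact pops_le_pushes R H E y t
  · rw [filter_val_lt_of_le _ (le_of_not_ge ht), filter_val_lt_of_le _ (le_of_not_ge ht), hbal]

/-- **The shed word is a ballot word** (whenever it is balanced). [folklore] -/
theorem isBallot_shedWord (hbal : (closerSet (shedWord R H E y)).card = (openerSet (shedWord R H E y)).card) :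
    IsBallot (shedWord R H E y) hbal :=
  InflateWord.isBallot_of_prefix_le hbal (card_closerSet_lt_le R H E y hbal)

/-- Defect positions are openers of the shed word. [folklore] -/
theorem shedWord_of_mem {i : Fin N} (hi : i ∈ R) : shedWord R H E y i = true := by
  rw [shedWord_apply]
  refine shedLetter_of_isDefect R H E y ?_
  simp only [isDefect, decide_eq_true_eq, mem_map]
  exact ⟨i, hi, rfl⟩

/-- **`R`-avoidance**: the FIFO partner of a defect is not a defect (defects push, partners of openers pop).
[folklore] -/
theorem fifo_shedWord_not_mem (hbal : (closerSet (shedWord R H E y)).card = (openerSet (shedWord R H E y)).card)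
    {i : Fin N} (hi : i ∈ R) : fifo (shedWord R H E y) hbal i ∉ R := by
  intro hmem
  obtain ⟨k, hk⟩ := exists_eq_opener (shedWord_of_mem R H E y hi)
  have h1 : shedWord R H E y (fifo (shedWord R H E y) hbal i) = false := by
    rw [← hk, fifo_opener]; exact apply_closer hbal k
  rw [shedWord_of_mem R H E y hmem] at h1
  exact Bool.noConfusion h1

/-- **Support lemma**: the FIFO matching of a balanced shed word is a nest-free perfect matching of the window
avoiding `R × R` — a member of the family `𝓕_R` of `…AvoidingCounts.lt_complexity_of_counts`. [folklore] -/
theorem fifo_shedWord_mem (hbal : (closerSet (shedWord R H E y)).card = (openerSet (shedWord R H E y)).card) :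
    fifo (shedWord R H E y) hbal ∈ (nestFreeMatchings N).filter (fun M => ∀ j ∈ R, M j ∉ R) :=
  mem_filter.2 ⟨fifo_mem_nestFreeMatchings (isBallot_shedWord R H E y hbal),
    fun _ hj => fifo_shedWord_not_mem R H E y hbal hj⟩

/-! ### The adaptive drain balances the word -/

/-- Splitting the non-defect count of `[a, c)` at `b`. [folklore] -/
theorem freeCount_add {a b c : ℕ} (hab : a ≤ b) (hbc : b ≤ c) :
    freeCount R a c = freeCount R a b + freeCount R b c := by
  unfold freeCount
  rw [← card_union_of_disjoint]
  · congr 1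
    ext t
    simp only [mem_filter, mem_range, mem_union]
    constructor
    · rintro ⟨htc, hat, hd⟩
      by_cases htb : t < b
      · exact Or.inl ⟨htb, hat, hd⟩
      · exact Or.inr ⟨htc, not_lt.1 htb, hd⟩
    · rintro (⟨htb, hat, hd⟩ | ⟨htc, hbt, hd⟩)
      · exact ⟨lt_of_lt_of_le htb hbc, hat, hd⟩
      · exact ⟨htc, hab.trans hbt, hd⟩
  · exact disjoint_left.2 fun t h1 h2 => absurd (mem_range.1 (mem_filter.1 h1).1) (not_lt.2 (mem_filter.1 h2).2.1)

/-- Splitting the defect count of `[a, c)` at `b`. [folklore] -/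
theorem defectCount_add {a b c : ℕ} (hab : a ≤ b) (hbc : b ≤ c) :
    defectCount R a c = defectCount R a b + defectCount R b c := by
  unfold defectCount
  rw [← card_union_of_disjoint]
  · congr 1
    ext t
    simp only [mem_filter, mem_range, mem_union]
    constructor
    · rintro ⟨htc, hat, hd⟩
      by_cases htb : t < b
      · exact Or.inl ⟨htb, hat, hd⟩
      · exact Or.inr ⟨htc, not_lt.1 htb, hd⟩
    · rintro (⟨htb, hat, hd⟩ | ⟨htc, hbt, hd⟩)
      · exact ⟨lt_of_lt_of_le htb hbc, hat, hd⟩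
      · exact ⟨htc, hab.trans hbt, hd⟩
  · exact disjoint_left.2 fun t h1 h2 => absurd (mem_range.1 (mem_filter.1 h1).1) (not_lt.2 (mem_filter.1 h2).2.1)

/-- One step of the non-defect count. [folklore] -/
theorem freeCount_succ {a t : ℕ} (hat : a ≤ t) :
    freeCount R a (t + 1) = freeCount R a t + (if isDefect R t = false then 1 else 0) := by
  rw [freeCount_add R hat (Nat.le_succ t)]
  congr 1
  unfold freeCount
  by_cases hd : isDefect R t = false
  · rw [if_pos hd, card_eq_one]
    refine ⟨t, ?_⟩
    ext s
    simp only [mem_filter, mem_range, mem_singleton]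
    constructor
    · rintro ⟨hs, hts, -⟩; omega
    · intro hst; rw [hst]; exact ⟨Nat.lt_succ_self t, le_rfl, hd⟩
  · rw [if_neg hd, card_eq_zero, filter_eq_empty_iff]
    rintro s hs ⟨hts, hds⟩
    have : s = t := by have := mem_range.1 hs; omega
    exact hd (this ▸ hds)

/-- One step of the defect count. [folklore] -/
theorem defectCount_succ {a t : ℕ} (hat : a ≤ t) :
    defectCount R a (t + 1) = defectCount R a t + (if isDefect R t = true then 1 else 0) := by
  rw [defectCount_add R hat (Nat.le_succ t)]
  congr 1
  unfold defectCount
  by_cases hd : isDefect R t = true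
  · rw [if_pos hd, card_eq_one]
    refine ⟨t, ?_⟩
    ext s
    simp only [mem_filter, mem_range, mem_singleton]
    constructor
    · rintro ⟨hs, hts, -⟩; omega
    · intro hst; rw [hst]; exact ⟨Nat.lt_succ_self t, le_rfl, hd⟩
  · rw [if_neg hd, card_eq_zero, filter_eq_empty_iff]
    rintro s hs ⟨hts, hds⟩
    have : s = t := by have := mem_range.1 hs; omega
    exact hd (this ▸ hds)

/-- Empty intervals. [folklore] -/
@[simp] theorem freeCount_self (a : ℕ) : freeCount R a a = 0 := by
  unfold freeCount; rw [card_eq_zero, filter_eq_empty_iff]; intro t ht h; exact absurd (mem_range.1 ht) (not_lt.2 h.1)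

/-- Empty intervals. [folklore] -/
@[simp] theorem defectCount_self (a : ℕ) : defectCount R a a = 0 := by
  unfold defectCount; rw [card_eq_zero, filter_eq_empty_iff]; intro t ht h; exact absurd (mem_range.1 ht) (not_lt.2 h.1)

/-- Every position of `[a, b)` is a defect or not. [folklore] -/
theorem freeCount_add_defectCount {a b : ℕ} (hab : a ≤ b) : freeCount R a b + defectCount R a b = b - a := by
  induction b, hab using Nat.le_induction with
  | base => simp
  | succ t hat ih =>
    rw [freeCount_succ R hat, defectCount_succ R hat]
    cases isDefect R t <;> simp <;> omega

/-- The tail push count does not depend on the time at which it is read (`t ≥ E`). [folklore] -/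
theorem tailPushes_shedPrefix {t : ℕ} (ht : E ≤ t) :
    tailPushes R E (shedPrefix R H E y t) = tailPushes R E (shedPrefix R H E y E) := by
  unfold tailPushes
  rw [take_shedPrefix R H E y ht, take_shedPrefix R H E y le_rfl]

/-- **Drain invariant.** From the tail start on, the pushes are the defects plus the first `tailPushes`
non-defect tail letters, and the pops are the remaining non-defect tail letters — provided `H ≤ E` and, in every
suffix starting at a non-defect tail position, non-defects outnumber defects (good ends), and the tail is long
enough for the height at `E` (`h(E) + r ≤ T`). [folklore] -/
theorem pushes_pops_tail (hHE : H ≤ E)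
    (hgood : ∀ t, E ≤ t → t < N → isDefect R t = false → defectCount R t N < freeCount R t N)
    (htail : height (shedPrefix R H E y E) + defectCount R E N ≤ freeCount R E N)
    (heven : Even (freeCount R E N - defectCount R E N - height (shedPrefix R H E y E)))
    {t : ℕ} (hEt : E ≤ t) (htN : t ≤ N) :
    pushes (shedPrefix R H E y t) = pushes (shedPrefix R H E y E) + defectCount R E t +
        min (freeCount R E t) (tailPushes R E (shedPrefix R H E y E)) ∧
      pops (shedPrefix R H E y t) = pops (shedPrefix R H E y E) +
        (freeCount R E t - min (freeCount R E t) (tailPushes R E (shedPrefix R H E y E))) := by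
  induction t, hEt using Nat.le_induction with
  | base => simp
  | succ t hEt ih =>
    obtain ⟨ih1, ih2⟩ := ih (Nat.le_of_succ_le htN)
    have htN' : t < N := htN
    set k := tailPushes R E (shedPrefix R H E y E) with hk
    have hk2 : 2 * k + height (shedPrefix R H E y E) + defectCount R E N = freeCount R E N := by
      obtain ⟨j, hj⟩ := heven
      have : k = j := by
        rw [hk, tailPushes, take_shedPrefix R H E y le_rfl]; omega
      omega
    have hhE : height (shedPrefix R H E y E) = pushes (shedPrefix R H E y E) - pops (shedPrefix R H E y E) := rfl
    have hpeE := pops_le_pushes R H E y E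
    have hsplitf := freeCount_add R hEt (le_of_lt htN')
    have hsplitd := defectCount_add R hEt (le_of_lt htN')
    rw [shedPrefix_succ, pushes_append_singleton, pops_append_singleton, freeCount_succ R hEt,
      defectCount_succ R hEt]
    by_cases hd : isDefect R t = true
    · -- a defect pushes
      have hl := shedLetter_of_isDefect R H E y hd
      simp only [hl, hd, Bool.true_eq_false, if_true, if_false, add_zero]
      exact ⟨by omega, by omega⟩
    rw [Bool.not_eq_true] at hd
    by_cases hlt : freeCount R E t < k
    · -- one of the first `k` non-defect tail letters: a push
      have hl : shedLetter R H E y t = true := by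
        by_cases he : pushes (shedPrefix R H E y t) ≤ pops (shedPrefix R H E y t)
        · exact shedLetter_of_empty R H E y he
        · rw [shedLetter_tail R H E y hd (hHE.trans hEt) (not_le.1 he) hEt, tailPushes_shedPrefix R H E y hEt,
            decide_eq_true_eq]
          exact hlt
      simp only [hl, hd, Bool.false_eq_true, if_true, if_false, add_zero]
      rw [min_eq_left (le_of_lt hlt)] at ih1 ih2
      rw [min_eq_left (Nat.succ_le_of_lt hlt)]
      exact ⟨by omega, by omega⟩
    · -- a later non-defect tail letter: a pop, the queue being non-empty by the good ends
      rw [not_lt] at hlt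
      rw [min_eq_right hlt] at ih1 ih2
      have hg := hgood t hEt htN' hd
      have hne : pops (shedPrefix R H E y t) < pushes (shedPrefix R H E y t) := by omega
      have hl : shedLetter R H E y t = false := by
        rw [shedLetter_tail R H E y hd (hHE.trans hEt) hne hEt, tailPushes_shedPrefix R H E y hEt,
          decide_eq_false_iff_not, not_lt]
        exact hlt
      simp only [hl, hd, Bool.false_eq_true, if_true, if_false, add_zero]
      rw [min_eq_right (hlt.trans (Nat.le_succ _))]
      exact ⟨by omega, by omega⟩

/-- **The adaptive drain balances the shed word**: under the hypotheses of `pushes_pops_tail` and for an even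
window length, the word has as many closers as openers. [folklore] -/
theorem balanced_shedWord (hN : Even N) (hHE : H ≤ E) (hEN : E ≤ N)
    (hgood : ∀ t, E ≤ t → t < N → isDefect R t = false → defectCount R t N < freeCount R t N)
    (htail : height (shedPrefix R H E y E) + defectCount R E N ≤ freeCount R E N) :
    (closerSet (shedWord R H E y)).card = (openerSet (shedWord R H E y)).card := by
  have hpeE := pops_le_pushes R H E y E
  have hlen := pushes_add_pops (shedPrefix R H E y E)
  rw [length_shedPrefix] at hlen
  have hfd := freeCount_add_defectCount R hEN
  have hhE : height (shedPrefix R H E y E) = pushes (shedPrefix R H E y E) - pops (shedPrefix R H E y E) := rfl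
  have heven : Even (freeCount R E N - defectCount R E N - height (shedPrefix R H E y E)) := by
    obtain ⟨m, hm⟩ := hN
    refine ⟨m + pops (shedPrefix R H E y E) - E - defectCount R E N, ?_⟩
    omega
  obtain ⟨h1, h2⟩ := pushes_pops_tail R H E y hHE hgood htail heven hEN le_rfl
  have hk2 : 2 * tailPushes R E (shedPrefix R H E y E) + height (shedPrefix R H E y E) + defectCount R E N =
      freeCount R E N := by
    obtain ⟨j, hj⟩ := heven
    have : tailPushes R E (shedPrefix R H E y E) = j := by
      rw [tailPushes, take_shedPrefix R H E y le_rfl]; omega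
    omega
  rw [min_eq_right (by omega)] at h1 h2
  rw [← filter_val_lt_of_le (closerSet (shedWord R H E y)) (le_refl N),
    ← filter_val_lt_of_le (openerSet (shedWord R H E y)) (le_refl N),
    ← pops_eq_card_closerSet R H E y le_rfl, ← pushes_eq_card_openerSet R H E y le_rfl]
  omega

end Queue

end Summit.ValiantsHypothesis.ValiantsHypothesis.Theorems.FifoMatching.NNLinearDegreeCofactorHard.ShedWord
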